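import Literature.MathematicalPhysics.QuantumLattice.PermutedTubeRealAnchors
import Literature.MathematicalPhysics.QuantumLattice.WightmanPermutedTubeAnchor
import Literature.MathematicalPhysics.QuantumLattice.WightmanLocality
import HarnessLib

/-!
# Consistency under permutations of the continued Wightman functions in every dimension `d ≥ 1`

Topic `Literature/MathematicalPhysics/QuantumLattice` (trunk T-AQFT). This file **proves** the named
fact (K) `IsWightmanQFT.extendedTube_continuation_perm_eq` (`WightmanPermutedTube`; the "single
valued, symmetric" clause of Osterwalder–Schrader I §5 p. 97 citing Jost (1965) p. 83,
Streater–Wightman (1964) Thm. 3-6) in every space dimension `d = m + 1 ≥ 1`, for every number of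
points and every permutation:

* `perm_eq_of_mem_relForwardTube` (**the function-theoretic statement**): let `𝔚` be analytic on the
  extended tube `𝒯'ₙ = ⋃_{Λ ∈ L₊(ℂ)} Λ𝒯ʳₙ` with a local distribution `T` as boundary value from `𝒯ₙ`.
  Then `𝔚(w ∘ σ) = 𝔚(w)` for every `w ∈ 𝒯ʳₙ` with `w ∘ σ ∈ 𝒯'ₙ`;
* `perm_eq_of_mem_relExtendedTube`: hence, if `𝔚` is moreover `L₊(ℂ)`-invariant, `𝔚(z ∘ σ) = 𝔚(z)`
  whenever `z, z ∘ σ ∈ 𝒯'ₙ`;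
* `IsWightmanQFT.extendedTube_continuation_perm_eq_holds_succ`: **(K) holds for `d = m + 1`**
  (locality of the Wightman distribution, `IsWightmanQFT.isLocalDistribution`, S–W Thm. 3-2 (d)).

The all-`d` statement and the discharge of `IsWightmanQFT.exists_symmetric_continuation` are
assembled in `SchwingerWightmanSymmetryProofs` (the case `d = 0` being trivial and already there).

## The argument (dimension independent; not the printed one)

The printed proofs (S–W Thm. 3-6, Jost Ch. IV) compare `𝔚` and `𝔚(· ∘ σ)` near the real Jost points
common to `𝒯'ₙ` and `σ𝒯'ₙ` and continue analytically, which requires knowing that every connected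
component of `𝒯'ₙ ∩ σ𝒯'ₙ` is reached — proved in print only for `d = 3` (Tomozawa; the route of
`WightmanPermutedTubeDim4Proofs`) and failing in `d = 1`, where common real points need not exist.
Here instead, for `w ∈ 𝒯ʳₙ` with `M(w ∘ σ) ∈ 𝒯ʳₙ`, `M ∈ L₊(ℂ)`:

1. (`PermutedTubeRealAnchors`) one may replace `M` by `M' ∈ L₊(ℂ)` with `M'(w ∘ σ) ∈ 𝒯ʳₙ` which in
   addition maps some real configuration `y` into `𝒯ʳₙ` (a trichotomy on the real kernel of
   `Im M`: a space-like kernel vector allows a small imaginary boost; a causal one forces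
   `σ ∈ {1, rev}`, and `rev` is served by the reflection `B_{iπ}`; a trivial kernel needs nothing);
2. the set `E = {w̃ ∈ 𝒯ʳₙ | M'(w̃ ∘ σ) ∈ 𝒯ʳₙ}` is convex, open, contains `w`, and contains the tube
   points `x + iεη` next to the real configuration `x = y ∘ σ⁻¹`, whose permutation `x ∘ σ = y` is a
   Jost point;
3. (`WightmanPermutedTubeAnchor`) next to such a one-sided Jost point, `𝔚(z ∘ σ) = 𝔚(z)` on the
   forward tube (uniqueness of distributional boundary values on a local tube + locality);
4. the identity theorem on the convex set `E` carries the agreement to `w`, and `L₊(ℂ)`-invariance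
   to all of `𝒯'ₙ ∩ σ𝒯'ₙ`.

## References

* K. Osterwalder, R. Schrader, Comm. Math. Phys. 31 (1973), §5 p. 97. [OsterwalderSchraderCMP1973]
* R. F. Streater, A. S. Wightman, *PCT, Spin and Statistics, and All That* (1964), Thm. 2-17,
  Thm. 3-2 (d), Thm. 3-6. [StreaterWightman1964]
* R. Jost, *The General Theory of Quantized Fields* (1965), p. 83. [Jost1965]

## Mathlib / tree

Used: `AnalyticOnNhd.eqOn_zero_of_preconnected_of_eventuallyEq_zero`, `Convex.isPreconnected`,
`Convex.linear_preimage`, `mem_nhds_iff`; from the tree `PermAnchor.exists_anchor`,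
`PermAnchor.smul_config_mem_relForwardTube`, `perm_eq_near_of_perm_real_mem`,
`IsWightmanQFT.isLocalDistribution`, `convex_relForwardTube`, `isOpen_relForwardTube`,
`isOpen_forwardTube`, `mem_forwardTube_of_mem_tubeCone`, `QuantumFieldTheory.stdDirection_mem_tubeCone`,
`lorentz_mem_relExtendedTube`, `diagAct`, `permConfig`.
-/

noncomputable section

open Filter Complex Set
open _root_.Topology
open scoped SchwartzMap

namespace Literature.MathematicalPhysics.QuantumLattice

variable {κ : Type*} {m n : ℕ}

section FunctionTheoretic

variable {𝔚 : (Fin n → Fin (m + 1 + 1) → ℂ) → ℂ} {T : 𝓢((Fin n → SpaceTime (m + 1)), ℂ) →L[ℂ] ℂ}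

/-- **Consistency under permutations on the relative forward tube** (space dimension `m + 1 ≥ 1`).
Let `𝔚` be analytic on `𝒯'ₙ` with a local distribution `T` (Streater–Wightman (3-34) on compact
supports) as distributional boundary value from `𝒯ₙ` (no Lorentz invariance of `𝔚` is needed here).
If `w ∈ 𝒯ʳₙ` and `w ∘ σ ∈ 𝒯'ₙ`, then `𝔚(w ∘ σ) = 𝔚(w)`. Proof: steps 1–4 of the module docstring.
[cite: OsterwalderSchraderCMP1973, §5 p. 97] -/
theorem perm_eq_of_mem_relForwardTube (h𝔚 : AnalyticOnNhd ℂ 𝔚 (relExtendedTube (m + 1) n))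
    (hbv : HasDistributionalBoundaryValue 𝔚 T)
    (hloc : ∀ (a b : Fin n), (a : ℕ) + 1 = b → ∀ F : 𝓢((Fin n → SpaceTime (m + 1)), ℂ),
      HasCompactSupport (F : (Fin n → SpaceTime (m + 1)) → ℂ) →
      tsupport (F : (Fin n → SpaceTime (m + 1)) → ℂ) ⊆ {x | IsSpacelike (x a - x b)} →
      T (permTest (Equiv.swap a b) F) = T F)
    (σ : Equiv.Perm (Fin n)) {w : Fin n → Fin (m + 1 + 1) → ℂ}
    (hw : w ∈ QuantumFieldTheory.relForwardTube (m + 1) n)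
    (hwσ : (fun k => w (σ k)) ∈ relExtendedTube (m + 1) n) :
    𝔚 (fun k => w (σ k)) = 𝔚 w := by
  by_cases hσ : σ = 1
  · subst hσ; rfl
  -- step 1: a Lorentz transformation taking `w ∘ σ` into `𝒯ʳₙ` and some real configuration too
  obtain ⟨Λ, hΛ, w₂, hw₂, hΛw⟩ := hwσ
  have hMw : (fun k => Λ⁻¹ (w (σ k))) ∈ QuantumFieldTheory.relForwardTube (m + 1) n := by
    have : (fun k => Λ⁻¹ (w (σ k))) = w₂ := by
      funext k
      have hk : w (σ k) = Λ (w₂ k) := congrFun hΛw k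
      rw [hk]
      simp
    rwa [this]
  obtain ⟨M', hM', hM'w, r, hr⟩ :=
    PermAnchor.exists_anchor hσ hw (Subgroup.inv_mem _ hΛ) hMw
  -- the real anchor `x = y ∘ σ⁻¹`, `y = (k r)_k`, `M' y ∈ 𝒯ʳₙ`
  set y : Fin n → SpaceTime (m + 1) := fun k => ((k : ℕ) : ℝ) • r with hy
  have hM'y : (fun k => M' (complexifyPoint (y k))) ∈ QuantumFieldTheory.relForwardTube (m + 1) n :=
    PermAnchor.smul_config_mem_relForwardTube hr
  set x : Fin n → SpaceTime (m + 1) := fun k => y (σ⁻¹ k) with hx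
  have hxσy : (fun k => complexifyPoint (x (σ k))) = fun k => complexifyPoint (y k) := by
    funext k; simp [hx]
  have hxσ : (fun k => complexifyPoint (x (σ k))) ∈ relExtendedTube (m + 1) n := by
    rw [hxσy]
    refine ⟨M'⁻¹, Subgroup.inv_mem _ hM', fun k => M' (complexifyPoint (y k)), hM'y, ?_⟩
    funext k; simp
  -- step 3: agreement on the forward tube next to `x`
  obtain ⟨U, hU, hUeq⟩ := perm_eq_near_of_perm_real_mem h𝔚 hbv hloc σ hxσ
  obtain ⟨U', hU'U, hU'o, hxU'⟩ := mem_nhds_iff.1 hU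
  -- step 2: the convex set `E = {u ∈ 𝒯ʳₙ | M'(u ∘ σ) ∈ 𝒯ʳₙ}`
  set E : Set (Fin n → Fin (m + 1 + 1) → ℂ) := QuantumFieldTheory.relForwardTube (m + 1) n ∩
    {u | (fun k => M' (u (σ k))) ∈ QuantumFieldTheory.relForwardTube (m + 1) n} with hE
  set L : (Fin n → Fin (m + 1 + 1) → ℂ) →L[ℂ] (Fin n → Fin (m + 1 + 1) → ℂ) :=
    (diagAct (m + 1) n M').comp (permConfig (m + 1) n σ) with hL
  have hLapply : ∀ u, L u = fun k => M' (u (σ k)) := fun u => by funext k; simp [hL]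
  have hEeq : E = QuantumFieldTheory.relForwardTube (m + 1) n ∩
      L ⁻¹' QuantumFieldTheory.relForwardTube (m + 1) n := by
    ext u
    simp only [hE, mem_inter_iff, mem_setOf_eq, mem_preimage, hLapply]
  have hEconv : Convex ℝ E := by
    rw [hEeq]
    exact convex_relForwardTube.inter
      (convex_relForwardTube.linear_preimage (L.toLinearMap.restrictScalars ℝ))
  have hEopen : IsOpen E := by
    rw [hEeq]
    exact isOpen_relForwardTube.inter (isOpen_relForwardTube.preimage L.continuous)
  have hwE : w ∈ E := ⟨hw, hM'w⟩
  -- the permuted points of `E` lie in `𝒯'ₙ`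
  have hEσ : ∀ u ∈ E, (fun k => u (σ k)) ∈ relExtendedTube (m + 1) n := by
    intro u hu
    refine ⟨M'⁻¹, Subgroup.inv_mem _ hM', fun k => M' (u (σ k)), hu.2, ?_⟩
    funext k; simp
  -- the difference is analytic on `E`
  set D : (Fin n → Fin (m + 1 + 1) → ℂ) → ℂ := fun u => 𝔚 (fun k => u (σ k)) - 𝔚 u with hD
  have hDan : AnalyticOnNhd ℂ D E := by
    intro u hu
    exact ((h𝔚 _ (hEσ u hu)).comp (analyticAt_permConfig σ u)).sub
      (h𝔚 u (relForwardTube_subset_relExtendedTube hu.1))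
  -- a tube point `z₀ = x + iεη` in `U' ∩ E`
  set η : Fin n → SpaceTime (m + 1) := fun k => (((k : ℕ) : ℝ) + 1) • e₀ (m + 1) with hη
  have hηC : η ∈ tubeCone (m + 1) n := QuantumFieldTheory.stdDirection_mem_tubeCone
  set γ : ℝ → Fin n → Fin (m + 1 + 1) → ℂ := fun ε => fun k =>
    complexifyPoint (x k) + ((ε : ℂ) * I) • complexifyPoint (η k) with hγ
  have hγc : Continuous γ :=
    continuous_pi fun k => continuous_const.add
      (((continuous_ofReal.comp continuous_id).mul continuous_const).smul continuous_const)
  have hγ0 : γ 0 = fun k => complexifyPoint (x k) := by funext k; simp [hγ]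
  have hev1 : ∀ᶠ ε in 𝓝 (0 : ℝ), γ ε ∈ U' := by
    refine hγc.continuousAt.eventually (hU'o.mem_nhds ?_)
    rwa [hγ0]
  have hev2 : ∀ᶠ ε in 𝓝 (0 : ℝ), (fun k => M' (γ ε (σ k))) ∈ QuantumFieldTheory.relForwardTube (m + 1) n := by
    have hc : Continuous fun ε => L (γ ε) := L.continuous.comp hγc
    have h0 : L (γ 0) ∈ QuantumFieldTheory.relForwardTube (m + 1) n := by
      rw [hγ0, hLapply]
      have : (fun k => M' (complexifyPoint (x (σ k)))) = fun k => M' (complexifyPoint (y k)) := by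
        funext k; simp [hx]
      rw [this]; exact hM'y
    have := hc.continuousAt.eventually (isOpen_relForwardTube.mem_nhds h0)
    filter_upwards [this] with ε hε
    rwa [hLapply] at hε
  have hev3 : ∀ᶠ ε in 𝓝[>] (0 : ℝ), 0 < ε := self_mem_nhdsWithin
  obtain ⟨ε, ⟨hεU, hεE⟩, hε⟩ :=
    (((hev1.and hev2).filter_mono nhdsWithin_le_nhds).and hev3).exists
  have hz₀T : γ ε ∈ forwardTube (m + 1) n := mem_forwardTube_of_mem_tubeCone x η hηC hε
  have hz₀E : γ ε ∈ E := ⟨QuantumFieldTheory.forwardTube_subset_relForwardTube hz₀T, hεE⟩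
  -- `D` vanishes near `z₀`
  have hD0 : D =ᶠ[𝓝 (γ ε)] 0 := by
    filter_upwards [(hU'o.inter isOpen_forwardTube).mem_nhds ⟨hεU, hz₀T⟩] with z hz
    exact sub_eq_zero.2 (hUeq z (hU'U hz.1) hz.2)
  -- step 4: identity theorem on the convex set `E`
  have := hDan.eqOn_zero_of_preconnected_of_eventuallyEq_zero hEconv.isPreconnected hz₀E hD0 hwE
  exact sub_eq_zero.1 this

/-- **Consistency under permutations on the extended tube** (space dimension `m + 1 ≥ 1`): under the
hypotheses of `perm_eq_of_mem_relForwardTube`, `𝔚(z ∘ σ) = 𝔚(z)` whenever `z` and `z ∘ σ` lie in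
`𝒯'ₙ` (reduce to `z = Λw`, `w ∈ 𝒯ʳₙ`, by `L₊(ℂ)`-invariance). [cite: OsterwalderSchraderCMP1973, §5 p. 97] -/
theorem perm_eq_of_mem_relExtendedTube (h𝔚 : AnalyticOnNhd ℂ 𝔚 (relExtendedTube (m + 1) n))
    (hbv : HasDistributionalBoundaryValue 𝔚 T)
    (hloc : ∀ (a b : Fin n), (a : ℕ) + 1 = b → ∀ F : 𝓢((Fin n → SpaceTime (m + 1)), ℂ),
      HasCompactSupport (F : (Fin n → SpaceTime (m + 1)) → ℂ) →
      tsupport (F : (Fin n → SpaceTime (m + 1)) → ℂ) ⊆ {x | IsSpacelike (x a - x b)} →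
      T (permTest (Equiv.swap a b) F) = T F)
    (hinv : ∀ Λ ∈ properComplexLorentzGroup (m + 1), ∀ z ∈ relExtendedTube (m + 1) n,
      𝔚 (fun i => Λ (z i)) = 𝔚 z)
    (σ : Equiv.Perm (Fin n)) {z : Fin n → Fin (m + 1 + 1) → ℂ}
    (hz : z ∈ relExtendedTube (m + 1) n) (hzσ : (fun k => z (σ k)) ∈ relExtendedTube (m + 1) n) :
    𝔚 (fun k => z (σ k)) = 𝔚 z := by
  obtain ⟨Λ, hΛ, w, hw, rfl⟩ := hz
  have hwσ : (fun k => w (σ k)) ∈ relExtendedTube (m + 1) n := by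
    have h : (fun k => Λ⁻¹ (Λ (w (σ k)))) ∈ relExtendedTube (m + 1) n :=
      lorentz_mem_relExtendedTube hzσ (Subgroup.inv_mem _ hΛ)
    have heq : (fun k => Λ⁻¹ (Λ (w (σ k)))) = fun k => w (σ k) := by
      funext k; simp
    rwa [heq] at h
  have key := perm_eq_of_mem_relForwardTube h𝔚 hbv hloc σ hw hwσ
  calc 𝔚 (fun k => Λ (w (σ k))) = 𝔚 (fun k => w (σ k)) := hinv Λ hΛ _ hwσ
    _ = 𝔚 w := key
    _ = 𝔚 (fun k => Λ (w k)) := (hinv Λ hΛ w (relForwardTube_subset_relExtendedTube hw)).symm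

end FunctionTheoretic

/-- **(K) holds in every space dimension `d = m + 1 ≥ 1`**: the Bargmann–Hall–Wightman continuation
of the `n`-point function of one hermitian scalar field of a Wightman QFT is consistent under
permutations on `𝒯'ₙ ∩ σ𝒯'ₙ` ("analytic, single valued, symmetric … for `(z₁, …, zₙ) ∈ S'ₙ`",
Osterwalder–Schrader I §5 p. 97, citing Jost (1965) p. 83; Streater–Wightman Thm. 3-6). Locality of
the Wightman distribution (S–W Thm. 3-2 (d), `IsWightmanQFT.isLocalDistribution`) feeds
`perm_eq_of_mem_relExtendedTube`. [cite: OsterwalderSchraderCMP1973, §5 p. 97] -/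
theorem IsWightmanQFT.extendedTube_continuation_perm_eq_holds_succ :
    IsWightmanQFT.extendedTube_continuation_perm_eq (d := m + 1) (κ := κ) := by
  intro W hW n k hk 𝔚 h𝔚 hT hinv σ z hz hzσ
  obtain ⟨T, hTW, hbv⟩ := hT
  exact perm_eq_of_mem_relExtendedTube h𝔚 hbv (hW.isLocalDistribution hTW hk) hinv σ hz hzσ

end Literature.MathematicalPhysics.QuantumLattice
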